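/-
Copyright (c) 2026 the pub-hodgecm-mathlib formalisation cell (harness21).  Prover seat hodgecm-mathlib-F0P2-p08 (g0) (L1; LEAD F0P6-plan (g14) BATCH #50 (4) «I2 → F0P2-p08»;
spec K2Liu-p02 (g7) CENSUS (u-0c) §1 row `hMID` «Iwasawa rewriting `hMIDF`»): Track B «K2-LIT», hLiu418 = stmt-HodgeConjecture-24832, road `K2_Liu`, socket #41, ROAD Φ,
organ G5 (u-0c) file I2 part 3: THE IWASAWA–LEVI REWRITING OF THE INNER SECTION `F` OF ★ α3-2, BY α3-2's OWN BINDERS (`n = 2`).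
-/
import Summits.HodgeConjecture.HodgeConjecture.Theorems.K2LiuConstantTermMiddleCellGL2        -- ★ α3-2 (+ α3-1 Prelims, α2d-2 Orbits, α1 Transport, α2c Levi)
import Summits.HodgeConjecture.HodgeConjecture.Theorems.K2LiuSiegelIwasawaLeviRewriting       -- ★ I2 part 2: `exists_unip_levi_mul_eq`, `integral_wt_smul_apply_unip_mul_eq`
import HarnessLib

/-!
# Crux `HLiu418`, ROAD Φ, organ G5 (u-0c) file I2 part 3: `F(Λ(ĝ)·h) = F(Λ(ĝ·m(h))·k(h))` for the inner section `F` of ★ α3-2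

Cell `hodgecm-mathlib`, crux item hLiu418 = `stmt-HodgeConjecture-24832`; squad K2 ∕ K2Liu (L1, LEAD F0P6-plan (g14)); prover F0P2-p08 (g0).  THEOREMS ONLY (no `def`,
no instance, no notation, no named-fact hypothesis, no `sorry`); lane `--supports stmt-HodgeConjecture-24832 --as helper`.

THE LETTERS (the last by-name step of the `hMID` row of K2Liu-p02's (u-0c) census: ★ α3-2 `middle_cell_eq_tsum` gives `MID(h) = Σ'_p F(Λ(γ̂_p)·h)` with
`F x = ∫ β₁(u) • f(w₀·(u·x)) dνN(u)`; ★ I2 part 1 gives `h = u₀·Λ(m(h))·k(h)`; this file gives `F(Λ(ĝ)·h) = F(Λ(ĝ·m(h))·k(h))` TERMWISE, under exactly α3-2's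
hypotheses at the point `h` — so `MID(h) = Σ'_p F(Λ(γ̂_p·m(h))·k(h))` is a `tsum_congr`).
* §1 (any `n`, any rational `γ₀`): `lintegral_enorm_apply_unip_mul_eq` — `∫⁻ ‖f(a·u·u'·x)‖ β₁(u) dνN = ∫⁻ ‖f(a·u·x)‖ β₁(u) dνN` for `u' ∈ N_Δ(𝔸)` (the `L¹` letter travels
  along `N_Δ(𝔸)`-translates; no finiteness needed); **`inner_section_unip_mul_eq`** — for a continuous Siegel section `f`, `γ₀ ∈ H(L⁺)`, `Γ' = Stab([γ₀])` (membership law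
  `hΓ'` verbatim as in ★ α3-1∕α3-2), a `Γ'`-weight `β₁` and `F x = ∫ β₁(u) • f(γ₀·(u·x)) dνN`: `F(u'·x) = F x` for `u' ∈ N_Δ(𝔸)` whenever `∫⁻ ‖f(γ₀ u x)‖ β₁ < ∞`
  (left-`Γ'`-invariance ★ `apply_translate_subgroup_mul`; ★ I2 part 2 §2).
* §2 (`n = 2`, α3-2's variable block `g₀ hg₀ Λ hΛ Γ₀ hΓ₀` verbatim): **`lintegral_inner_levi_ne_top`** — α3-2's hypothesis (H) `hH` at `h` gives
  `∫⁻ ‖f(w₀·(u·(Λ(ĝ)·h)))‖ β₁(u) dνN < ∞` for every `g ∈ GL₂(L)` (α3-2's internal chain, exported: orbit piece ★ `lintegral_orbit_ne_top` at `γ₀ = w₀Λĝ`, transport along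
  `u ↦ Λĝ u Λĝ⁻¹` ★ `lintegral_mul_comp_mulEquiv`, ★ `stabilizer_levi_iff`); **`inner_section_levi_mul_eq`** — `F(Λ(ĝ)·h) = F(Λ(ĝ·m)·k)` whenever `h·k⁻¹ ∈ P_Δ(𝔸)` has
  `Δ`-block `m` (★ I2 part 2 `exists_unip_levi_mul_eq` + §1).
[MoeglinWaldspurger1995, II.1.7]; [CogdellAnalyticTheory2004, §2.3]; [BorelJacquet1979, §4.1].
HONEST LABEL.  Count-neutral helper: `HC_CM` is proved only modulo the 7 printed citations (2 remaining named inputs: hLiu418 = `stmt-HodgeConjecture-24832`,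
h413 = `stmt-HodgeConjecture-24833`) until rung 0 closes; this file closes no socket.
-/

set_option autoImplicit false
set_option linter.dupNamespace false -- the mandated namespace repeats `HodgeConjecture.HodgeConjecture`

noncomputable section

open scoped Matrix ENNReal NNReal
open NumberField IsDedekindDomain MeasureTheory MeasureTheory.Measure Filter Set Function
open Literature.NumberTheory.Automorphic Literature.NumberTheory.Automorphic.UnitaryGroup Literature.NumberTheory.GaloisRepresentations
open Literature.NumberTheory.GelbartRogawski1991 Literature.NumberTheory.GelbartRogawski1991.GRConstruction
open Literature.NumberTheory.GelbartRogawski1991.AdaptedBlocks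
open Literature.NumberTheory.K2Lit.SiegelDoubled Literature.MeasureTheory.Group
open UnitaryDualPair

namespace Summit.HodgeConjecture.HodgeConjecture.Cruxes.HLiu418.K2LiuSiegelIwasawaLeviInnerSection

open K2LiuUnipotentCoveringWeight K2LiuConstantTermBigCellUnfold K2LiuSiegelDoubledUnfold K2LiuConstantTermDelta
  K2LiuSiegelEisensteinCoeffCells K2LiuSiegelEisensteinCoeffOrbitSum K2LiuSiegelBruhatMiddleCellDelta K2LiuSiegelEisensteinCoeffNondegenerate
  K2LiuSiegelEisensteinCoeffMiddleOrbits K2LiuSiegelMiddleOrbitUnfold K2LiuCoveringWeightTransport K2LiuSiegelRationalLeviDecomposition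
  K2LiuSiegelMiddleCellLeviCriterion K2LiuConstantTermMiddleCellOrbits K2LiuConstantTermMiddleCellPrelims K2LiuSiegelIwasawaLeviRewriting

variable {L : Type} [Field L] [NumberField L] [IsCMField L]

/-! ## §1 The inner section is left-`N_Δ(𝔸)`-invariant (any `n`) -/

section Generic

variable {N M n : ℕ} {e : Fin N × Fin M ≃ Fin n}
  {dV : Fin N → L} {hdV : ∀ i, IsCMField.complexConj L (dV i) = dV i}
  {dW : Fin M → L} {hdW : ∀ i, IsCMField.complexConj L (dW i) = dW i}
variable [MeasurableSpace (unipDelta L e dV hdV dW hdW)] [BorelSpace (unipDelta L e dV hdV dW hdW)]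

/-- **THE `L¹` LETTER TRAVELS ALONG `N_Δ(𝔸)`**: `∫⁻ ‖f(a·(u·(u'·x)))‖ₑ β₁(u) dνN(u) = ∫⁻ ‖f(a·(u·x))‖ₑ β₁(u) dνN(u)` for `u' ∈ N_Δ(𝔸)`, `νN` left-invariant on the
abelian `N_Δ(𝔸)`, `Γ₀ ≤ N_Δ(𝔸)` countable, `β₁` a `Γ₀`-weight and `y ↦ f(a·y)` left-`Γ₀`-invariant (Tonelli twin of ★ I2 part 2 `integral_wt_smul_apply_unip_mul_eq`; no
finiteness). [cite: MoeglinWaldspurger1995, II.1.7] [cite: CogdellAnalyticTheory2004, §2.3] -/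
theorem lintegral_enorm_apply_unip_mul_eq (νN : Measure (unipDelta L e dV hdV dW hdW)) [νN.IsMulLeftInvariant]
    {Γ₀ : Subgroup (unipDelta L e dV hdV dW hdW)} [Countable Γ₀] {β₁ : unipDelta L e dV hdV dW hdW → ℝ≥0∞} (hβ₁ : IsCoveringWeight Γ₀ β₁)
    {f : HA L e dV hdV dW hdW → ℂ} (hfc : Continuous f) (a x : HA L e dV hdV dW hdW)
    (hinv : ∀ γ : unipDelta L e dV hdV dW hdW, γ ∈ Γ₀ → ∀ y : HA L e dV hdV dW hdW, f (a * ((γ : HA L e dV hdV dW hdW) * y)) = f (a * y))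
    (u' : unipDelta L e dV hdV dW hdW) :
    ∫⁻ u, ‖f (a * ((u : HA L e dV hdV dW hdW) * (((u' : unipDelta L e dV hdV dW hdW) : HA L e dV hdV dW hdW) * x)))‖ₑ * β₁ u ∂νN =
      ∫⁻ u, ‖f (a * ((u : HA L e dV hdV dW hdW) * x))‖ₑ * β₁ u ∂νN := by
  haveI : MeasurableConstSMul Γ₀ (unipDelta L e dV hdV dW hdW) := ⟨fun γ => measurable_const_mul (γ : unipDelta L e dV hdV dW hdW)⟩
  haveI : SMulInvariantMeasure Γ₀ (unipDelta L e dV hdV dW hdW) νN :=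
    ⟨fun γ t _ht => by
      rw [show (fun v : unipDelta L e dV hdV dW hdW => γ • v) ⁻¹' t = (fun v => (γ : unipDelta L e dV hdV dW hdW) * v) ⁻¹' t from rfl, measure_preimage_mul]⟩
  -- move `u'` into the weight (right translation = left translation on the abelian `N_Δ(𝔸)`)
  have hsub : ∫⁻ u, ‖f (a * ((u : HA L e dV hdV dW hdW) * (((u' : unipDelta L e dV hdV dW hdW) : HA L e dV hdV dW hdW) * x)))‖ₑ * β₁ u ∂νN =
      ∫⁻ v, ‖f (a * ((v : HA L e dV hdV dW hdW) * x))‖ₑ * β₁ (v * u'⁻¹) ∂νN := by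
    have hcomm : (fun v : unipDelta L e dV hdV dW hdW => ‖f (a * (((v * u' : unipDelta L e dV hdV dW hdW) : HA L e dV hdV dW hdW) * x))‖ₑ * β₁ (v * u' * u'⁻¹)) =
        fun v => ‖f (a * (((u' * v : unipDelta L e dV hdV dW hdW) : HA L e dV hdV dW hdW) * x))‖ₑ * β₁ (u' * v * u'⁻¹) :=
      funext fun v => by rw [show v * u' = u' * v from Subtype.ext (mul_comm_of_mem_unipDelta L e dV hdV dW hdW v.2 u'.2)]
    rw [← lintegral_mul_left_eq_self (fun v : unipDelta L e dV hdV dW hdW => ‖f (a * ((v : HA L e dV hdV dW hdW) * x))‖ₑ * β₁ (v * u'⁻¹)) u', ← hcomm]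
    refine lintegral_congr fun u => ?_
    simp only [mul_inv_cancel_right]
    simp only [Subgroup.coe_mul, mul_assoc]
  rw [hsub]
  have hβ₂ := isCoveringWeight_mul_right L e dV hdV dW hdW hβ₁ u'⁻¹
  refine (lintegral_mul_eq_of_coveringSum_eq (Γ := Γ₀) νN (measurable_enorm_apply_mul_coe_mul' hfc a x) (fun γ v => ?_) hβ₁.1 hβ₂.1 one_ne_zero
    ENNReal.one_ne_top hβ₁.2 hβ₂.2).symm
  simp only [Subgroup.smul_def, smul_eq_mul, Subgroup.coe_mul, mul_assoc]
  rw [hinv _ γ.2 _]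

/-- **THE INNER SECTION IS LEFT-`N_Δ(𝔸)`-INVARIANT** (α3-2's currency): `f` a continuous Siegel section, `γ₀ ∈ H(L⁺)`, `Γ' = Stab([γ₀])` by its membership law,
`β₁` a `Γ'`-covering weight, `F x = ∫ β₁(u) • f(γ₀·(u·x)) dνN(u)`; if `∫⁻ ‖f(γ₀·(u·x))‖ₑ β₁(u) dνN < ∞` then `F(u'·x) = F x` for every `u' ∈ N_Δ(𝔸)` — `y ↦ f(γ₀·y)` is
left-`Γ'`-invariant (★ `apply_translate_subgroup_mul`: `γ₀ γ γ₀⁻¹ ∈ P_Δ(L⁺)` acts by `σ = 1`), then ★ I2 part 2 `integral_wt_smul_apply_unip_mul_eq`.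
[cite: MoeglinWaldspurger1995, II.1.7] [cite: CogdellAnalyticTheory2004, §2.3] -/
theorem inner_section_unip_mul_eq (νN : Measure (unipDelta L e dV hdV dW hdW)) [νN.IsMulLeftInvariant]
    {χ : HeckeCharacter L} {s : ℂ} {f : HA L e dV hdV dW hdW → ℂ} (hf : IsSiegelDeltaSection L e dV hdV dW hdW χ s f) (hfc : Continuous f)
    (γ₀ : ratH L e dV hdV dW hdW) (Γ' : Subgroup (unipDelta L e dV hdV dW hdW))
    (hΓ' : ∀ u : unipDelta L e dV hdV dW hdW, u ∈ Γ' ↔ (u : HA L e dV hdV dW hdW) ∈ ratH L e dV hdV dW hdW ∧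
      IsSiegelDelta L e dV hdV dW hdW ((γ₀ : HA L e dV hdV dW hdW) * (u : HA L e dV hdV dW hdW) * ((γ₀ : HA L e dV hdV dW hdW))⁻¹))
    {β₁ : unipDelta L e dV hdV dW hdW → ℝ≥0∞} (hβ₁ : IsCoveringWeight Γ' β₁)
    (F : HA L e dV hdV dW hdW → ℂ) (hF : ∀ x, F x = ∫ u, (β₁ u).toReal • f ((γ₀ : HA L e dV hdV dW hdW) * ((u : HA L e dV hdV dW hdW) * x)) ∂νN)
    (x : HA L e dV hdV dW hdW) (hint : ∫⁻ u, ‖f ((γ₀ : HA L e dV hdV dW hdW) * ((u : HA L e dV hdV dW hdW) * x))‖ₑ * β₁ u ∂νN ≠ ∞)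
    (u' : HA L e dV hdV dW hdW) (hu' : u' ∈ unipDelta L e dV hdV dW hdW) :
    F (u' * x) = F x := by
  have hΓ'le : Γ' ≤ unipDeltaRat L e dV hdV dW hdW := fun u hu => (mem_unipDeltaRat_iff L e dV hdV dW hdW u).2 ((hΓ' u).1 hu).1
  haveI : Countable (unipDeltaRat L e dV hdV dW hdW) := countable_unipDeltaRat L e dV hdV dW hdW
  haveI : Countable Γ' := (Subgroup.inclusion_injective hΓ'le).countable
  have hΓ'rat : ∀ γ ∈ Γ', ((γ : unipDelta L e dV hdV dW hdW) : HA L e dV hdV dW hdW) ∈ ratH L e dV hdV dW hdW := fun γ hγ => ((hΓ' γ).1 hγ).1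
  have hΓ'P : ∀ γ ∈ Γ', IsSiegelDelta L e dV hdV dW hdW
      ((γ₀ : HA L e dV hdV dW hdW) * ((γ : unipDelta L e dV hdV dW hdW) : HA L e dV hdV dW hdW) * ((γ₀ : HA L e dV hdV dW hdW))⁻¹) := fun γ hγ => ((hΓ' γ).1 hγ).2
  have hinv : ∀ γ : unipDelta L e dV hdV dW hdW, γ ∈ Γ' → ∀ y : HA L e dV hdV dW hdW,
      f ((γ₀ : HA L e dV hdV dW hdW) * (((γ : unipDelta L e dV hdV dW hdW) : HA L e dV hdV dW hdW) * y)) = f ((γ₀ : HA L e dV hdV dW hdW) * y) := by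
    intro γ hγ y
    have h1 := apply_translate_subgroup_mul hf γ₀ y Γ' hΓ'rat hΓ'P hγ 1
    simpa only [mul_one, OneMemClass.coe_one, one_mul, mul_assoc] using h1
  rw [hF, hF]
  exact integral_wt_smul_apply_unip_mul_eq L e dV hdV dW hdW νN hβ₁ hfc (γ₀ : HA L e dV hdV dW hdW) x hinv hint ⟨u', hu'⟩

end Generic

/-! ## §2 `n = 2`: the `L¹` letter at `Λ(ĝ)·h` from (H), and `F(Λ(ĝ)·h) = F(Λ(ĝ·m)·k)` -/

section Two

variable {N M : ℕ} {e : Fin N × Fin M ≃ Fin 2}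
  {dV : Fin N → L} {hdV : ∀ i, IsCMField.complexConj L (dV i) = dV i}
  {dW : Fin M → L} {hdW : ∀ i, IsCMField.complexConj L (dW i) = dW i}
variable [MeasurableSpace (unipDelta L e dV hdV dW hdW)] [BorelSpace (unipDelta L e dV hdV dW hdW)]

variable {g₀ : UnitaryGroup.rationalPair (Fp L) L (IsCMField.complexConj L) N M (Matrix.diagonal dV) (Matrix.diagonal dW)}
  (Λ : GL (Fin 2) (AdeleRing (𝓞 L) L) →* HA L e dV hdV dW hdW)
  (hΛ : ∀ g : GL (Fin 2) (AdeleRing (𝓞 L) L), blk L e dV hdV dW hdW (Λ g) =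
    cayR (AdeleRing (𝓞 L) L) (Fin 2) * Matrix.fromBlocks (g : Matrix (Fin 2) (Fin 2) (AdeleRing (𝓞 L) L)) 0 0
      (((gramR L e dV hdV dW hdW).map ((algebraMap L (AdeleRing (𝓞 L) L)).comp (algebraMap (Fp L) L)))⁻¹ *
        (((g⁻¹ : GL (Fin 2) (AdeleRing (𝓞 L) L)) : Matrix (Fin 2) (Fin 2) (AdeleRing (𝓞 L) L)).map
          (conjAdele (Fp L) L (IsCMField.complexConj L)))ᵀ *
        (gramR L e dV hdV dW hdW).map ((algebraMap L (AdeleRing (𝓞 L) L)).comp (algebraMap (Fp L) L))) *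
      cayRinv (AdeleRing (𝓞 L) L) (Fin 2))
  (Γ₀ : Subgroup (unipDelta L e dV hdV dW hdW))
  (hΓ₀ : ∀ u : unipDelta L e dV hdV dW hdW, u ∈ Γ₀ ↔ (u : HA L e dV hdV dW hdW) ∈ ratH L e dV hdV dW hdW ∧
    IsSiegelDelta L e dV hdV dW hdW (iotaGG L e dV hdV dW hdW (1, UnitaryGroup.rationalPairToAdelic (Fp L) L (IsCMField.complexConj L) N M (Matrix.diagonal dV) (Matrix.diagonal dW) g₀) * (u : HA L e dV hdV dW hdW) * (iotaGG L e dV hdV dW hdW (1, UnitaryGroup.rationalPairToAdelic (Fp L) L (IsCMField.complexConj L) N M (Matrix.diagonal dV) (Matrix.diagonal dW) g₀))⁻¹))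

include hΛ hΓ₀ in
/-- **THE `L¹` LETTER AT `Λ(ĝ)·h` FROM (H)** (α3-2's internal chain, exported): under α3-2's hypothesis (H) `hH` at `h` (absolute convergence of the whole constant term),
for every `g ∈ GL₂(L)` with `u ↦ Λĝ u Λĝ⁻¹` `νN`-preserving, `∫⁻ ‖f(w₀·(u·(Λ(ĝ)·h)))‖ₑ β₁(u) dνN(u) < ∞` — the orbit piece of (H) at `γ₀ = w₀Λĝ` (★ α3-1
`lintegral_orbit_ne_top` with the `Stab([w₀Λĝ]) = Λĝ⁻¹Γ₀Λĝ`-weight `β₁ ∘ conj(Λĝ)`, ★ α2d-2 `stabilizer_levi_iff`) transported along `conj(Λĝ)` (★ α1 `lintegral_mul_comp_mulEquiv`).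
[cite: MoeglinWaldspurger1995, II.1.7] [cite: CogdellAnalyticTheory2004, §2.3] -/
theorem lintegral_inner_levi_ne_top (hdV0 : ∀ i, dV i ≠ 0) (hdW0 : ∀ i, dW i ≠ 0) (νN : Measure (unipDelta L e dV hdV dW hdW)) [νN.IsMulLeftInvariant]
    {β : unipDelta L e dV hdV dW hdW → ℝ≥0∞} (hβ : IsCoveringWeight (unipDeltaRat L e dV hdV dW hdW) β)
    {χ : HeckeCharacter L} {s : ℂ} {f : HA L e dV hdV dW hdW → ℂ} (hf : IsSiegelDeltaSection L e dV hdV dW hdW χ s f) (hfc : Continuous f)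
    (h : HA L e dV hdV dW hdW)
    (hH : ∫⁻ u, (∑' q : SiegelDeltaQuot L e dV hdV dW hdW,
        ‖f ((((Quotient.out q : ratH L e dV hdV dW hdW) : HA L e dV hdV dW hdW)) * ((u : HA L e dV hdV dW hdW) * h))‖ₑ) * β u ∂νN ≠ ∞)
    {β₁ : unipDelta L e dV hdV dW hdW → ℝ≥0∞} (hβ₁ : IsCoveringWeight Γ₀ β₁) (g : GL (Fin 2) L)
    (hconj : MeasurePreserving (fun u : unipDelta L e dV hdV dW hdW =>
      (⟨Λ (Matrix.GeneralLinearGroup.map (algebraMap L (AdeleRing (𝓞 L) L)) g) * (u : HA L e dV hdV dW hdW) *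
          (Λ (Matrix.GeneralLinearGroup.map (algebraMap L (AdeleRing (𝓞 L) L)) g))⁻¹,
        conj_levi_mem_unipDelta L e dV hdV dW hdW Λ hΛ _ u.2⟩ : unipDelta L e dV hdV dW hdW)) νN νN) :
    ∫⁻ u, ‖f (iotaGG L e dV hdV dW hdW (1, UnitaryGroup.rationalPairToAdelic (Fp L) L (IsCMField.complexConj L) N M (Matrix.diagonal dV) (Matrix.diagonal dW) g₀) *
        ((u : HA L e dV hdV dW hdW) * (Λ (Matrix.GeneralLinearGroup.map (algebraMap L (AdeleRing (𝓞 L) L)) g) * h)))‖ₑ * β₁ u ∂νN ≠ ∞ := by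
  classical
  haveI : Countable (unipDeltaRat L e dV hdV dW hdW) := countable_unipDeltaRat L e dV hdV dW hdW
  have hw₀r : iotaGG L e dV hdV dW hdW (1, UnitaryGroup.rationalPairToAdelic (Fp L) L (IsCMField.complexConj L) N M (Matrix.diagonal dV) (Matrix.diagonal dW) g₀) ∈ ratH L e dV hdV dW hdW :=
    iotaGG_one_mem_ratH L e dV hdV dW hdW g₀
  have hγ₀ : iotaGG L e dV hdV dW hdW (1, UnitaryGroup.rationalPairToAdelic (Fp L) L (IsCMField.complexConj L) N M (Matrix.diagonal dV) (Matrix.diagonal dW) g₀) *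
      Λ (Matrix.GeneralLinearGroup.map (algebraMap L (AdeleRing (𝓞 L) L)) g) ∈ ratH L e dV hdV dW hdW :=
    mul_mem hw₀r (levi_map_mem_ratH L e dV hdV dW hdW Λ hΛ hdV0 hdW0 g)
  -- the conjugation automorphism `φ = conj(Λĝ)` of `N_Δ(𝔸)`
  obtain ⟨φ, hφ, hφs⟩ := exists_conj_mulEquiv (Λ (Matrix.GeneralLinearGroup.map (algebraMap L (AdeleRing (𝓞 L) L)) g))
    (fun u hu => conj_levi_mem_unipDelta L e dV hdV dW hdW Λ hΛ _ hu) (fun u hu => inv_conj_levi_mem_unipDelta L e dV hdV dW hdW Λ hΛ _ hu)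
  have hφfun : (φ : unipDelta L e dV hdV dW hdW → unipDelta L e dV hdV dW hdW) = fun u : unipDelta L e dV hdV dW hdW =>
      (⟨Λ (Matrix.GeneralLinearGroup.map (algebraMap L (AdeleRing (𝓞 L) L)) g) * (u : HA L e dV hdV dW hdW) *
          (Λ (Matrix.GeneralLinearGroup.map (algebraMap L (AdeleRing (𝓞 L) L)) g))⁻¹,
        conj_levi_mem_unipDelta L e dV hdV dW hdW Λ hΛ _ u.2⟩ : unipDelta L e dV hdV dW hdW) := funext fun u => Subtype.ext (hφ u)
  have hφsfun : (φ.symm : unipDelta L e dV hdV dW hdW → unipDelta L e dV hdV dW hdW) = fun u : unipDelta L e dV hdV dW hdW =>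
      (⟨(Λ (Matrix.GeneralLinearGroup.map (algebraMap L (AdeleRing (𝓞 L) L)) g))⁻¹ * (u : HA L e dV hdV dW hdW) *
          Λ (Matrix.GeneralLinearGroup.map (algebraMap L (AdeleRing (𝓞 L) L)) g),
        inv_conj_levi_mem_unipDelta L e dV hdV dW hdW Λ hΛ _ u.2⟩ : unipDelta L e dV hdV dW hdW) := funext fun u => Subtype.ext (hφs u)
  have hφm : Measurable (φ : unipDelta L e dV hdV dW hdW → unipDelta L e dV hdV dW hdW) := by
    rw [hφfun]
    exact (Continuous.subtype_mk ((continuous_const.mul continuous_subtype_val).mul continuous_const) _).measurable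
  have hφsm : Measurable (φ.symm : unipDelta L e dV hdV dW hdW → unipDelta L e dV hdV dW hdW) := by
    rw [hφsfun]
    exact (Continuous.subtype_mk ((continuous_const.mul continuous_subtype_val).mul continuous_const) _).measurable
  have hmp : MeasurePreserving φ νN νN := by
    rw [hφfun]
    exact hconj
  -- `Stab([w₀Λĝ]) = Γ₀.comap φ` and its weight `β₁ ∘ φ`
  have hΓ'law : ∀ u : unipDelta L e dV hdV dW hdW, u ∈ Γ₀.comap φ.toMonoidHom ↔ (u : HA L e dV hdV dW hdW) ∈ ratH L e dV hdV dW hdW ∧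
      IsSiegelDelta L e dV hdV dW hdW ((((⟨_, hγ₀⟩ : ratH L e dV hdV dW hdW)) : HA L e dV hdV dW hdW) * (u : HA L e dV hdV dW hdW) *
        ((((⟨_, hγ₀⟩ : ratH L e dV hdV dW hdW)) : HA L e dV hdV dW hdW))⁻¹) := by
    intro u
    rw [Subgroup.mem_comap, MulEquiv.coe_toMonoidHom, hΓ₀ (φ u), hφ u, Subtype.coe_mk]
    exact (stabilizer_levi_iff Λ hΛ hdV0 hdW0 g (u : HA L e dV hdV dW hdW)).symm
  have hβ₁' : IsCoveringWeight (Γ₀.comap φ.toMonoidHom) (fun u => β₁ (φ u)) := isCoveringWeight_comp φ hφm Γ₀ hβ₁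
  -- the orbit piece of (H) at `γ₀ = w₀Λĝ`
  have hO : ∫⁻ u, (∑' q : ↥(Set.range (fun ν : unipDeltaRat L e dV hdV dW hdW =>
        (Quotient.mk (MulAction.orbitRel (siegelDeltaRat L e dV hdV dW hdW) (ratH L e dV hdV dW hdW))
          ((⟨_, hγ₀⟩ : ratH L e dV hdV dW hdW) * ⟨((ν : unipDelta L e dV hdV dW hdW) : HA L e dV hdV dW hdW), coe_mem_ratH ν⟩)))),
        ‖f (((Quotient.out q.1 : ratH L e dV hdV dW hdW) : HA L e dV hdV dW hdW) * ((u : HA L e dV hdV dW hdW) * h))‖ₑ) * β u ∂νN ≠ ∞ := by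
    refine ne_top_of_le_ne_top hH (lintegral_mono fun u => mul_le_mul' ?_ le_rfl)
    exact ENNReal.tsum_comp_le_tsum_of_injective Subtype.val_injective
      (fun q : SiegelDeltaQuot L e dV hdV dW hdW => ‖f ((((Quotient.out q : ratH L e dV hdV dW hdW) : HA L e dV hdV dW hdW)) * ((u : HA L e dV hdV dW hdW) * h))‖ₑ)
  have horb := lintegral_orbit_ne_top νN hβ hf hfc ⟨_, hγ₀⟩ h (Γ₀.comap φ.toMonoidHom) hΓ'law hβ₁' hO
  -- `Γ₀`-bookkeeping for the transported integrand `Φ(u) = ‖f(w₀ u (Λĝ h))‖ₑ`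
  have hΓ₀le : Γ₀ ≤ unipDeltaRat L e dV hdV dW hdW := fun u hu => (mem_unipDeltaRat_iff L e dV hdV dW hdW u).2 ((hΓ₀ u).1 hu).1
  haveI : Countable Γ₀ := (Subgroup.inclusion_injective hΓ₀le).countable
  have hΓ₀rat : ∀ γ ∈ Γ₀, ((γ : unipDelta L e dV hdV dW hdW) : HA L e dV hdV dW hdW) ∈ ratH L e dV hdV dW hdW := fun γ hγ => ((hΓ₀ γ).1 hγ).1
  have hΓ₀P : ∀ γ ∈ Γ₀, IsSiegelDelta L e dV hdV dW hdW
      ((((⟨_, hw₀r⟩ : ratH L e dV hdV dW hdW)) : HA L e dV hdV dW hdW) * ((γ : unipDelta L e dV hdV dW hdW) : HA L e dV hdV dW hdW) *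
        ((((⟨_, hw₀r⟩ : ratH L e dV hdV dW hdW)) : HA L e dV hdV dW hdW))⁻¹) := fun γ hγ => ((hΓ₀ γ).1 hγ).2
  have hΦinv : ∀ γ ∈ Γ₀, ∀ u : unipDelta L e dV hdV dW hdW,
      ‖f ((((⟨_, hw₀r⟩ : ratH L e dV hdV dW hdW)) : HA L e dV hdV dW hdW) * (((γ * u : unipDelta L e dV hdV dW hdW)) : HA L e dV hdV dW hdW) *
          (Λ (Matrix.GeneralLinearGroup.map (algebraMap L (AdeleRing (𝓞 L) L)) g) * h))‖ₑ =
        ‖f ((((⟨_, hw₀r⟩ : ratH L e dV hdV dW hdW)) : HA L e dV hdV dW hdW) * (u : HA L e dV hdV dW hdW) *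
          (Λ (Matrix.GeneralLinearGroup.map (algebraMap L (AdeleRing (𝓞 L) L)) g) * h))‖ₑ :=
    fun γ hγ u => by rw [apply_translate_subgroup_mul hf ⟨_, hw₀r⟩ _ Γ₀ hΓ₀rat hΓ₀P hγ u]
  -- transport along `φ`: `f(w₀Λĝ · u · h) = Φ(φ u)`
  have htr := lintegral_mul_comp_mulEquiv νN φ hφm hφsm hmp Γ₀ hβ₁ hβ₁'
    (F := fun u : unipDelta L e dV hdV dW hdW => ‖f ((((⟨_, hw₀r⟩ : ratH L e dV hdV dW hdW)) : HA L e dV hdV dW hdW) * (u : HA L e dV hdV dW hdW) *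
      (Λ (Matrix.GeneralLinearGroup.map (algebraMap L (AdeleRing (𝓞 L) L)) g) * h))‖ₑ)
    (measurable_enorm_apply_mul_coe_mul hfc _ _) hΦinv
  have hΦeq : ∀ u : unipDelta L e dV hdV dW hdW, f ((((⟨_, hγ₀⟩ : ratH L e dV hdV dW hdW)) : HA L e dV hdV dW hdW) * (u : HA L e dV hdV dW hdW) * h) =
      f ((((⟨_, hw₀r⟩ : ratH L e dV hdV dW hdW)) : HA L e dV hdV dW hdW) * ((φ u : unipDelta L e dV hdV dW hdW) : HA L e dV hdV dW hdW) *
        (Λ (Matrix.GeneralLinearGroup.map (algebraMap L (AdeleRing (𝓞 L) L)) g) * h)) := by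
    intro u
    rw [hφ u, Subtype.coe_mk, Subtype.coe_mk]
    simp only [mul_assoc, inv_mul_cancel_left]
  have hfin : ∫⁻ u, ‖f ((((⟨_, hw₀r⟩ : ratH L e dV hdV dW hdW)) : HA L e dV hdV dW hdW) * (u : HA L e dV hdV dW hdW) *
      (Λ (Matrix.GeneralLinearGroup.map (algebraMap L (AdeleRing (𝓞 L) L)) g) * h))‖ₑ * β₁ u ∂νN ≠ ∞ := by
    rw [← htr]
    refine ne_of_eq_of_ne (lintegral_congr fun u => ?_) horb
    rw [hΦeq u]
  refine ne_of_eq_of_ne (lintegral_congr fun u => ?_) hfin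
  rw [Subtype.coe_mk, mul_assoc]

include hΛ hΓ₀ in
/-- **THE IWASAWA–LEVI REWRITING OF THE INNER SECTION**: under α3-2's hypotheses at `h` ((H) `hH`, `Γ₀ = Stab([w₀])`-weight `β₁`, `hconj` for `g`,
`F x = ∫ β₁(u) • f(w₀·(u·x)) dνN`), for `k` with `h·k⁻¹ ∈ P_Δ(𝔸)` of `Δ`-block `m ∈ GL₂(𝔸_L)` (★ I2 part 1 `exists_iwasawaLeviCoordinate` supplies `k = kx h`, `m = mx h`):
  `F(Λ(ĝ)·h) = F(Λ(ĝ·m)·k)`.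
(`Λ(ĝ)·h = u'·(Λ(ĝ·m)·k)` with `u' ∈ N_Δ(𝔸)` ★ I2 part 2; `F` is left-`N_Δ(𝔸)`-invariant at `Λ(ĝ·m)·k` by §1, its `L¹` letter being that of `lintegral_inner_levi_ne_top` moved
along `u'` by `lintegral_enorm_apply_unip_mul_eq`.)  With ★ α3-2 `middle_cell_eq_tsum`: `MID(h) = Σ'_p F(Λ(γ̂_p·m(h))·k(h))` by `tsum_congr`.
[cite: MoeglinWaldspurger1995, II.1.7] [cite: BorelJacquet1979, §4.1] [cite: CogdellAnalyticTheory2004, §2.3] -/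
theorem inner_section_levi_mul_eq (hdV0 : ∀ i, dV i ≠ 0) (hdW0 : ∀ i, dW i ≠ 0) (νN : Measure (unipDelta L e dV hdV dW hdW)) [νN.IsMulLeftInvariant]
    {β : unipDelta L e dV hdV dW hdW → ℝ≥0∞} (hβ : IsCoveringWeight (unipDeltaRat L e dV hdV dW hdW) β)
    {χ : HeckeCharacter L} {s : ℂ} {f : HA L e dV hdV dW hdW → ℂ} (hf : IsSiegelDeltaSection L e dV hdV dW hdW χ s f) (hfc : Continuous f)
    (h k : HA L e dV hdV dW hdW) (hp : IsSiegelDelta L e dV hdV dW hdW (h * k⁻¹))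
    {m : GL (Fin 2) (AdeleRing (𝓞 L) L)} (hm : (m : Matrix (Fin 2) (Fin 2) (AdeleRing (𝓞 L) L)) = deltaBlock L e dV hdV dW hdW (h * k⁻¹))
    (hH : ∫⁻ u, (∑' q : SiegelDeltaQuot L e dV hdV dW hdW,
        ‖f ((((Quotient.out q : ratH L e dV hdV dW hdW) : HA L e dV hdV dW hdW)) * ((u : HA L e dV hdV dW hdW) * h))‖ₑ) * β u ∂νN ≠ ∞)
    {β₁ : unipDelta L e dV hdV dW hdW → ℝ≥0∞} (hβ₁ : IsCoveringWeight Γ₀ β₁) (g : GL (Fin 2) L)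
    (hconj : MeasurePreserving (fun u : unipDelta L e dV hdV dW hdW =>
      (⟨Λ (Matrix.GeneralLinearGroup.map (algebraMap L (AdeleRing (𝓞 L) L)) g) * (u : HA L e dV hdV dW hdW) *
          (Λ (Matrix.GeneralLinearGroup.map (algebraMap L (AdeleRing (𝓞 L) L)) g))⁻¹,
        conj_levi_mem_unipDelta L e dV hdV dW hdW Λ hΛ _ u.2⟩ : unipDelta L e dV hdV dW hdW)) νN νN)
    (F : HA L e dV hdV dW hdW → ℂ)
    (hF : ∀ x, F x = ∫ u, (β₁ u).toReal •
      f (iotaGG L e dV hdV dW hdW (1, UnitaryGroup.rationalPairToAdelic (Fp L) L (IsCMField.complexConj L) N M (Matrix.diagonal dV) (Matrix.diagonal dW) g₀) *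
        ((u : HA L e dV hdV dW hdW) * x)) ∂νN) :
    F (Λ (Matrix.GeneralLinearGroup.map (algebraMap L (AdeleRing (𝓞 L) L)) g) * h) =
      F (Λ (Matrix.GeneralLinearGroup.map (algebraMap L (AdeleRing (𝓞 L) L)) g * m) * k) := by
  have hw₀r : iotaGG L e dV hdV dW hdW (1, UnitaryGroup.rationalPairToAdelic (Fp L) L (IsCMField.complexConj L) N M (Matrix.diagonal dV) (Matrix.diagonal dW) g₀) ∈ ratH L e dV hdV dW hdW :=
    iotaGG_one_mem_ratH L e dV hdV dW hdW g₀
  -- `Λĝ·h = u'·(Λ(ĝ·m)·k)`, `u' ∈ N_Δ(𝔸)`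
  obtain ⟨u', hu', hgh⟩ := exists_unip_levi_mul_eq L e dV hdV dW hdW Λ hΛ hdV0 hdW0 h k hp hm (Matrix.GeneralLinearGroup.map (algebraMap L (AdeleRing (𝓞 L) L)) g)
  -- the `L¹` letter at `Λĝ·h`, moved to `Λ(ĝ·m)·k`
  have hint := lintegral_inner_levi_ne_top Λ hΛ Γ₀ hΓ₀ hdV0 hdW0 νN hβ hf hfc h hH hβ₁ g hconj
  rw [hgh] at hint ⊢
  -- `Γ₀`-bookkeeping (countable; the invariance letter of §1)
  have hΓ₀le : Γ₀ ≤ unipDeltaRat L e dV hdV dW hdW := fun u hu => (mem_unipDeltaRat_iff L e dV hdV dW hdW u).2 ((hΓ₀ u).1 hu).1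
  haveI : Countable (unipDeltaRat L e dV hdV dW hdW) := countable_unipDeltaRat L e dV hdV dW hdW
  haveI : Countable Γ₀ := (Subgroup.inclusion_injective hΓ₀le).countable
  have hΓ₀rat : ∀ γ ∈ Γ₀, ((γ : unipDelta L e dV hdV dW hdW) : HA L e dV hdV dW hdW) ∈ ratH L e dV hdV dW hdW := fun γ hγ => ((hΓ₀ γ).1 hγ).1
  have hΓ₀P : ∀ γ ∈ Γ₀, IsSiegelDelta L e dV hdV dW hdW
      ((((⟨_, hw₀r⟩ : ratH L e dV hdV dW hdW)) : HA L e dV hdV dW hdW) * ((γ : unipDelta L e dV hdV dW hdW) : HA L e dV hdV dW hdW) *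
        ((((⟨_, hw₀r⟩ : ratH L e dV hdV dW hdW)) : HA L e dV hdV dW hdW))⁻¹) := fun γ hγ => ((hΓ₀ γ).1 hγ).2
  have hinv : ∀ γ : unipDelta L e dV hdV dW hdW, γ ∈ Γ₀ → ∀ y : HA L e dV hdV dW hdW,
      f (iotaGG L e dV hdV dW hdW (1, UnitaryGroup.rationalPairToAdelic (Fp L) L (IsCMField.complexConj L) N M (Matrix.diagonal dV) (Matrix.diagonal dW) g₀) *
          (((γ : unipDelta L e dV hdV dW hdW) : HA L e dV hdV dW hdW) * y)) =
        f (iotaGG L e dV hdV dW hdW (1, UnitaryGroup.rationalPairToAdelic (Fp L) L (IsCMField.complexConj L) N M (Matrix.diagonal dV) (Matrix.diagonal dW) g₀) * y) := by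
    intro γ hγ y
    have h1 := apply_translate_subgroup_mul hf ⟨_, hw₀r⟩ y Γ₀ hΓ₀rat hΓ₀P hγ 1
    simpa only [mul_one, OneMemClass.coe_one, one_mul, mul_assoc] using h1
  have hint' := hint
  rw [show (u' : HA L e dV hdV dW hdW) = (((⟨u', hu'⟩ : unipDelta L e dV hdV dW hdW)) : HA L e dV hdV dW hdW) from rfl] at hint'
  rw [lintegral_enorm_apply_unip_mul_eq νN hβ₁ hfc _ _ hinv ⟨u', hu'⟩] at hint'
  exact inner_section_unip_mul_eq νN hf hfc ⟨_, hw₀r⟩ Γ₀ hΓ₀ hβ₁ F hF _ hint' u' hu'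

end Two

end Summit.HodgeConjecture.HodgeConjecture.Cruxes.HLiu418.K2LiuSiegelIwasawaLeviInnerSection

end
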